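import Summits.QuantumFields.BalabanUV.T4Continuum.Support.SmallFieldDomainsDensity
import Summits.QuantumFields.BalabanUV.T4Continuum.Support.SmallFieldDomainsContourGap

/-!
# T⁴ programme, SUBSTRATE — `Support/SmallFieldDomainsDensityRowSum`: THE MULTI-LAYER COUNT `#{y ∈ 𝔅 : d_Ω(x, y) ≤ n} ≤ C₀·e^{κ₀n}` (closed and
# exponential forms, constants explicit), the (2.61)-SHAPE ROW SUM `Σ_{y∈𝔅} e^{−κ d_Ω(x,y)} ≤ C₀e^{κ₀}·e/(e−1)` over the lattice representatives of a
# GENUINE multi-level big-block domain sequence, and [B9] p. 398 «(3.47) ⇐ (3.42) + Lemma 2.1» with BOTH geometric inputs ((2.60) separation, (2.61) row sum)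
# PROVED — LIBRARY W-11 → row L-C6 «(2.61)-shape row sum; `WSupLePrint.of_localDecay_reps` = L-B5's END with `hrow` DISCHARGED»; typed: typer ruling
# (λ1) l.17442 (the `hcard`∕`hrow` hypotheses of `SmallFieldDomainsRowSum.sum_exp_neg_msDistΩ_le` and `SmallFieldDomainsContour.WSupLePrint.of_localDecay_msDistΩ`
# DISCHARGED for lattice representatives)

Audit cell `pub-balaban`, SUBSTRATE cell seat p4 (gen 3); same namespace as `Support/SmallFieldDomains{,RowSum,Contour,ContourGap,Density}` (`sum_exp_neg_msDistΩ_le`,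
`WSupLePrint.of_localDecay_msDistΩ`, `repPt`∕`ptIndex_repPt`∕`isLevel_repPt`, `ptIndex_window_of_msDistΩ_lt`, `l1_le_of_msDistΩ_lt`, `card_filter_isLevel_box_le` BY NAME).

WHAT IS PRINTED (documentation; nothing asserted).  [Balaban1984PropagatorsII] Lemma 2.1 (2.61) p. 234 *"sup_{y∈𝔅} Σ_{y′∈𝔅} e^{−αδ₀d(y,y′)} ≦ c₁(α)"*;
[Balaban1985BackgroundPropagators] (= [B9]) p. 398 *"It is easy to see that the global inequalities (3.47) are consequences of the local ones (3.42) and Lemma 2.1."*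
(the printed constant `c₁(α)` of (2.61) is NOT claimed — cf. `Literature/…/B6Lemma21Counterexample` ∕ `B6Lemma21Repaired` for the abstract chain over
`B6.Geometry`, where the row-sum bound (2.61′) is recorded as «the ONLY remaining analytic leaf … not formalised»; what is proved below is its COUNTERPART
for the cell's concrete `ℤ^d` distance `d_Ω` (MAP §O1 (2.46)′: a different, fine-path distance — no inequality with `B6.Geometry.dist` is claimed), with
the cell's own constants, explicit, crude and true).
WHAT THIS FILE PROVIDES (all `[folklore]`; `A := 2c/(R·M₁)`):
 * §1 **`card_filter_msDistΩ_le_closedForm`**: for a finite set `S` of lattice representatives (each `y ∈ S` a level-`ι(y)` lattice point), any `x`, any `n`: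
   `#{y ∈ S : d_Ω(x,y) ≤ n} ≤ (2W + 1)·(4c(n+1)·L^{2W} + 2)^d`, `W = 1 + ⌊2c(n+1)/(R·M₁)⌋` (index window × level-wise box count, `Density` §2–§3);
 * §2 **`card_filter_msDistΩ_le_exp`**: `… ≤ C₀·e^{κ₀ n}`, `C₀ = (3 + 2A)(4c + 2)^d·e^{2(1+A)d·log L}`, `κ₀ = 1 + d(1 + 2A·log L)` — the growth rate `κ₀`
   carries the printed mechanism «`R·M` large against `log L`» explicitly (`2dA·log L = 4dc·log L/(R·M₁)`);
 * §3 **`sum_exp_neg_msDistΩ_reps_le`**: the (2.61)-shape row sum for every `κ ≥ κ₀ + 1`, uniform in `x`, `S`, `k` and the sequence; and the (2.63)-shape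
   composition `sum_exp_mul_exp_msDistΩ_reps_le` (`SmallFieldDomainsRowSum.sum_exp_mul_exp_msDistΩ_le` with its row sum discharged); the same row sum
   over print's `𝔅 = repPt(T)` for an arbitrary finite `T` (`isLevel_of_mem_image_repPt`, `sum_exp_neg_msDistΩ_image_repPt_le`);
 * §4 **`WSupLePrint.of_localDecay_reps`**: `SmallFieldDomainsContour.WSupLePrint.of_localDecay_msDistΩ` with `hrow` discharged — for kernels localised at
   lattice representatives `S ⊆ Ω₀`, a (3.42)-shape blockwise majorant in `e^{−δ₀ d_Ω}` ALONE gives `WSupLePrint s Ω γ f B → WSupLePrint s Ω (σ+γ) P (…·B)`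
   as soon as `δ₀ − |γ|·log L·(2c)/(R·M₁) ≥ κ₀ + 1`; what remains a hypothesis is exactly the printed local estimate (3.42).
HOW THE RATE CONDITION IS MET (numbers, not adjectives).  `κ₀` depends on `(d, L, c, R·M₁)` only: e.g. `d = 4`, `L = 2`, `c = 1`, `R·M₁ = 28` give
`A = 1/14`, `κ₀ = 1 + 4·(1 + (1/7)·log 2) ≈ 5.40`, so the row sum holds for every `κ ≥ 6.40` (and `C₀ = (3 + 1/7)·6⁴·2^{8·15/14} ≈ 1.5·10⁶` — crude:
polynomial growth was bounded by `e^{(d+1)n}`).  The decay rate `κ` here multiplies the cell's distance `d_Ω` built on the scales `s i = c·L^i`; a kernel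
decaying like `e^{−δ·dist/L^j}` in layer `j` (any fixed `δ > 0`) has `κ = δ·c` in these letters, so the condition `κ ≥ κ₀ + 1` is met by CHOOSING the scale
constant `c ≥ (d + 3)/δ` and `R·M₁ ≥ 4dc·log L` (then `2dA·log L ≤ 1`) — the printed regime «`R·M` large» of [B6] (2.59); the (3.41)-weights change with
`c` by constant factors only.
HONEST FRAMING (T4-DAG p. 1).  COUNTING and real analysis on finite sums; no configuration, no estimate of any NE row ((3.42)∕(1.5)-type local bounds are the
rows'); spine 0/9 unchanged; NOT infinite volume, NOT a mass gap, NOT Clay.  HONEST DEPENDENCY: continuum YM on T⁴ ⇐ BetaPertH ∧ nine spine estimates (0/9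
proved); BetaPertH ⇐ (D1) ∧ (D4) ∧ CAP+tail; G-an2-4 gates asym, D1 and NE2/3/4.  No `sorry`.
-/

noncomputable section

open scoped BigOperators

namespace Summit.QuantumFields.BalabanUV.T4Continuum.SmallFieldDomains

open Literature.MathematicalPhysics.QuantumFieldTheory.Balaban1983to89.B14DomainGeom
open Literature.MathematicalPhysics.QuantumFieldTheory.Balaban1983to89.B8ConstraintBonds (IsLevel)
open Literature.MathematicalPhysics.QuantumFieldTheory.Balaban1983to89.B7Prop1Explicit (l1)

variable {d : ℕ}

/-! ## §1 The multi-layer count in closed form -/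

section ClosedForm
variable {L M₁ R k : ℕ} {Ω : ℕ → Set (Pt d)} {s : ℕ → ℝ}

/-- One coordinate is dominated by the `ℓ¹` norm. [folklore] -/
theorem abs_apply_le_l1 (v : Pt d) (μ : Fin d) : |v μ| ≤ (l1 v : ℤ) := by
  unfold l1
  push_cast
  have : ((v μ).natAbs : ℤ) ≤ ∑ κ, ((v κ).natAbs : ℤ) :=
    Finset.single_le_sum (f := fun κ => ((v κ).natAbs : ℤ)) (fun κ _ => by positivity) (Finset.mem_univ μ)
  simpa [Int.natCast_natAbs] using this

/-- **THE MULTI-LAYER COUNT, CLOSED FORM** ([B6] (2.56)–(2.59)'s counting content for the cell's distance `d_Ω`): for a big-block domain sequence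
with geometric scales `s i = c·L^i` (`c > 0`, `L ≥ 1`, `R·M₁ > 0`), a finite set `S` of LATTICE REPRESENTATIVES (each `y ∈ S` a level-`ι(y)` lattice
point — print's `𝔅 = ⋃_j Λ_j`), any base point `x` and any radius `n`,
`#{y ∈ S : d_Ω(x, y) ≤ n} ≤ (2W + 1)·(4c(n+1)·L^{2W} + 2)^d`, `W = 1 + ⌊2c(n+1)/(R·M₁)⌋`
(index window `|ι y − ι x| ≤ W` by the crossings, `ℓ¹`-radius `2c(n+1)L^{ι x + W}` by confinement, then level-by-level lattice counting). [folklore] -/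
theorem card_filter_msDistΩ_le_closedForm (hΩ : BigDomainSeq L M₁ R k Ω) {c : ℝ} (hc : 0 < c) (hL : 1 ≤ L)
    (hsc : ∀ i, s i = c * (L : ℝ) ^ i) (hRM : (0 : ℝ) < R * M₁) (S : Finset (Pt d)) (hS : ∀ y ∈ S, IsLevel L (ptIndex k Ω y) y)
    (x : Pt d) (n : ℕ) :
    ((S.filter (fun y => msDistΩ s k Ω x y ≤ n)).card : ℝ) ≤
      (2 * ((1 + ⌊2 * c * ((n : ℝ) + 1) / (R * M₁)⌋₊ : ℕ) : ℝ) + 1) *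
        (4 * c * ((n : ℝ) + 1) * (L : ℝ) ^ (2 * (1 + ⌊2 * c * ((n : ℝ) + 1) / (R * M₁)⌋₊)) + 2) ^ d := by
  classical
  set B : ℝ := (n : ℝ) + 1 with hB
  have hB0 : 0 ≤ B := by positivity
  set W : ℕ := 1 + ⌊2 * c * B / (R * M₁)⌋₊ with hW
  set m : ℕ := ptIndex k Ω x + W with hm
  set N : ℕ := ⌊2 * c * B * (L : ℝ) ^ m⌋₊ with hN
  have hLr : (1 : ℝ) ≤ L := by exact_mod_cast hL
  have hL0 : (0 : ℝ) < L := by linarith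
  set T := S.filter (fun y => msDistΩ s k Ω x y ≤ n) with hT
  -- (a) what membership in `T` gives
  have hmem : ∀ y ∈ T, (ptIndex k Ω y ≤ ptIndex k Ω x + W ∧ ptIndex k Ω x ≤ ptIndex k Ω y + W) ∧
      (∀ μ, |y μ - x μ| ≤ (N : ℤ)) ∧ IsLevel L (ptIndex k Ω y) y := by
    intro y hy
    rw [hT, Finset.mem_filter] at hy
    obtain ⟨hyS, hyn⟩ := hy
    have hlt : msDistΩ s k Ω x y < B := by rw [hB]; linarith
    refine ⟨ptIndex_window_of_msDistΩ_lt hΩ hc hL hsc hRM hB0 hlt, fun μ => ?_, hS y hyS⟩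
    have h1 := l1_le_of_msDistΩ_lt hΩ hc hL hsc hRM hB0 hlt
    have h2 : l1 (y - x) ≤ N := Nat.le_floor h1
    have h3 := abs_apply_le_l1 (y - x) μ
    rw [Pi.sub_apply] at h3
    exact h3.trans (by exact_mod_cast h2)
  -- (b) cover `T` by the level-wise box counts over the index window
  set I : Finset ℕ := Finset.Icc (ptIndex k Ω x - W) (ptIndex k Ω x + W) with hI
  have hcover : T ⊆ I.biUnion (fun i => S.filter (fun y => IsLevel L i y ∧ ∀ μ, |y μ - x μ| ≤ (N : ℤ))) := by
    intro y hy
    obtain ⟨⟨hw1, hw2⟩, hbox, hlev⟩ := hmem y hy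
    rw [hT, Finset.mem_filter] at hy
    rw [Finset.mem_biUnion]
    refine ⟨ptIndex k Ω y, ?_, ?_⟩
    · rw [hI, Finset.mem_Icc]; omega
    · rw [Finset.mem_filter]; exact ⟨hy.1, hlev, hbox⟩
  -- (c) the per-level bound, uniform over the window: `2N/L^i ≤ 4cB·L^{2W}`
  have hlevel : ∀ i ∈ I, ((S.filter (fun y => IsLevel L i y ∧ ∀ μ, |y μ - x μ| ≤ (N : ℤ))).card : ℝ) ≤
      (4 * c * B * (L : ℝ) ^ (2 * W) + 2) ^ d := by
    intro i hi
    rw [hI, Finset.mem_Icc] at hi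
    have hmi : m ≤ i + 2 * W := by omega
    have hpow : (L : ℝ) ^ m ≤ (L : ℝ) ^ i * (L : ℝ) ^ (2 * W) := by
      rw [← pow_add]; exact pow_le_pow_right₀ hLr hmi
    have hLi : (0 : ℝ) < (L : ℝ) ^ i := pow_pos hL0 i
    have hNle : (N : ℝ) ≤ 2 * c * B * (L : ℝ) ^ m := Nat.floor_le (by positivity)
    have hratio : 2 * (N : ℝ) / (L : ℝ) ^ i ≤ 4 * c * B * (L : ℝ) ^ (2 * W) := by
      rw [div_le_iff₀ hLi]
      calc 2 * (N : ℝ) ≤ 2 * (2 * c * B * (L : ℝ) ^ m) := by linarith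
        _ ≤ 2 * (2 * c * B * ((L : ℝ) ^ i * (L : ℝ) ^ (2 * W))) := by
            have : 0 ≤ 2 * c * B := by positivity
            nlinarith
        _ = 4 * c * B * (L : ℝ) ^ (2 * W) * (L : ℝ) ^ i := by ring
    calc ((S.filter (fun y => IsLevel L i y ∧ ∀ μ, |y μ - x μ| ≤ (N : ℤ))).card : ℝ)
        ≤ (2 * (N : ℝ) / (L : ℝ) ^ i + 2) ^ d := card_filter_isLevel_box_le hL i x N S
      _ ≤ (4 * c * B * (L : ℝ) ^ (2 * W) + 2) ^ d :=
          pow_le_pow_left₀ (by positivity) (by linarith) d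
  -- (d) assemble
  have hIcard : (I.card : ℝ) ≤ 2 * (W : ℝ) + 1 := by
    rw [hI, Nat.card_Icc]
    have : ptIndex k Ω x + W + 1 - (ptIndex k Ω x - W) ≤ 2 * W + 1 := by omega
    exact_mod_cast this
  calc (T.card : ℝ) ≤ ((I.biUnion (fun i => S.filter (fun y => IsLevel L i y ∧ ∀ μ, |y μ - x μ| ≤ (N : ℤ)))).card : ℝ) := by
        exact_mod_cast Finset.card_le_card hcover
    _ ≤ ∑ i ∈ I, ((S.filter (fun y => IsLevel L i y ∧ ∀ μ, |y μ - x μ| ≤ (N : ℤ))).card : ℝ) := by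
        exact_mod_cast Finset.card_biUnion_le
    _ ≤ ∑ _i ∈ I, (4 * c * B * (L : ℝ) ^ (2 * W) + 2) ^ d := Finset.sum_le_sum hlevel
    _ = (I.card : ℝ) * (4 * c * B * (L : ℝ) ^ (2 * W) + 2) ^ d := by rw [Finset.sum_const, nsmul_eq_mul]
    _ ≤ (2 * (W : ℝ) + 1) * (4 * c * B * (L : ℝ) ^ (2 * W) + 2) ^ d :=
        mul_le_mul_of_nonneg_right hIcard (by positivity)

end ClosedForm

/-! ## §2 The count in exponential form `C₀·e^{κ₀ n}` -/

section Exponential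
variable {L M₁ R k : ℕ} {Ω : ℕ → Set (Pt d)} {s : ℕ → ℝ}

/-- Elementary: `2w + 1 ≤ (3 + 2A)·e^n` when `w ≤ 1 + A(n+1)`, `A ≥ 0`. [folklore] -/
theorem two_mul_add_one_le_exp {w A : ℝ} {n : ℕ} (hA : 0 ≤ A) (hw : w ≤ 1 + A * ((n : ℝ) + 1)) :
    2 * w + 1 ≤ (3 + 2 * A) * Real.exp n := by
  have hn : (0 : ℝ) ≤ n := Nat.cast_nonneg n
  have he : (n : ℝ) + 1 ≤ Real.exp n := by have := Real.add_one_le_exp (n : ℝ); linarith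
  have h1 : 2 * w + 1 ≤ (3 + 2 * A) * ((n : ℝ) + 1) := by nlinarith
  exact h1.trans (mul_le_mul_of_nonneg_left he (by positivity))

/-- Elementary: `L^{2W} ≤ e^{2(1+A)·log L}·e^{(2A·log L)·n}` when `W ≤ 1 + A(n+1)`, `L ≥ 1`. [folklore] -/
theorem pow_two_mul_le_exp {L : ℕ} (hL : 1 ≤ L) {W : ℕ} {A : ℝ} {n : ℕ} (hW : (W : ℝ) ≤ 1 + A * ((n : ℝ) + 1)) :
    (L : ℝ) ^ (2 * W) ≤ Real.exp (2 * (1 + A) * Real.log L) * Real.exp (2 * A * Real.log L * n) := by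
  have hLr : (1 : ℝ) ≤ L := by exact_mod_cast hL
  have hL0 : (0 : ℝ) < L := by linarith
  have hlog : 0 ≤ Real.log L := Real.log_nonneg hLr
  rw [← Real.exp_add]
  have e1 : (L : ℝ) ^ (2 * W) = Real.exp (((2 * W : ℕ) : ℝ) * Real.log L) := by
    rw [Real.exp_nat_mul, Real.exp_log hL0]
  rw [e1]
  refine Real.exp_le_exp.mpr ?_
  have hn : (0 : ℝ) ≤ n := Nat.cast_nonneg n
  push_cast
  nlinarith

/-- **THE MULTI-LAYER COUNT, EXPONENTIAL FORM**: with `A = 2c/(R·M₁)`,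
`#{y ∈ S : d_Ω(x, y) ≤ n} ≤ C₀ · e^{κ₀·n}`, `C₀ = (3 + 2A)·(4c + 2)^d·e^{2(1+A)·d·log L}`, `κ₀ = 1 + d·(1 + 2A·log L)`
— the DENSITY HYPOTHESIS `hcard` of `SmallFieldDomainsRowSum.sum_exp_neg_msDistΩ_le` PROVED for lattice representatives of a big-block domain sequence. [folklore] -/
theorem card_filter_msDistΩ_le_exp (hΩ : BigDomainSeq L M₁ R k Ω) {c : ℝ} (hc : 0 < c) (hL : 1 ≤ L)
    (hsc : ∀ i, s i = c * (L : ℝ) ^ i) (hRM : (0 : ℝ) < R * M₁) (S : Finset (Pt d)) (hS : ∀ y ∈ S, IsLevel L (ptIndex k Ω y) y)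
    (x : Pt d) (n : ℕ) :
    ((S.filter (fun y => msDistΩ s k Ω x y ≤ n)).card : ℝ) ≤
      ((3 + 2 * (2 * c / (R * M₁))) * (4 * c + 2) ^ d * Real.exp (2 * (1 + 2 * c / (R * M₁)) * d * Real.log L)) *
        Real.exp ((1 + d * (1 + 2 * (2 * c / (R * M₁)) * Real.log L)) * n) := by
  -- the closed form (taken before the abbreviations, so that `set` rewrites it)
  have hcl := card_filter_msDistΩ_le_closedForm hΩ hc hL hsc hRM S hS x n
  push_cast at hcl
  set A : ℝ := 2 * c / (R * M₁) with hA
  have hA0 : 0 ≤ A := by positivity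
  set B : ℝ := (n : ℝ) + 1 with hB
  have hB1 : 1 ≤ B := by rw [hB]; linarith [Nat.cast_nonneg (α := ℝ) n]
  set W : ℕ := 1 + ⌊2 * c * B / (R * M₁)⌋₊ with hW
  have hLr : (1 : ℝ) ≤ L := by exact_mod_cast hL
  have hconv : ((S.filter (fun y => msDistΩ s k Ω x y ≤ n)).card : ℝ) ≤
      (2 * (W : ℝ) + 1) * (4 * c * B * (L : ℝ) ^ (2 * W) + 2) ^ d := by
    rw [hW]; push_cast; exact hcl
  -- `W ≤ 1 + A·B`
  have hWle : (W : ℝ) ≤ 1 + A * ((n : ℝ) + 1) := by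
    have h1 : (⌊2 * c * B / (R * M₁)⌋₊ : ℝ) ≤ 2 * c * B / (R * M₁) := Nat.floor_le (by positivity)
    have h2 : 2 * c * B / (R * M₁) = A * ((n : ℝ) + 1) := by rw [hA, hB]; ring
    rw [hW]; push_cast; linarith
  have hn : (0 : ℝ) ≤ n := Nat.cast_nonneg n
  have hexpn : B ≤ Real.exp n := by rw [hB]; have := Real.add_one_le_exp (n : ℝ); linarith
  -- the two elementary exponential bounds
  have h1 : 2 * (W : ℝ) + 1 ≤ (3 + 2 * A) * Real.exp n := two_mul_add_one_le_exp hA0 hWle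
  have h2 : (L : ℝ) ^ (2 * W) ≤ Real.exp (2 * (1 + A) * Real.log L) * Real.exp (2 * A * Real.log L * n) :=
    pow_two_mul_le_exp hL hWle
  set E₁ : ℝ := Real.exp (2 * (1 + A) * Real.log L) with hE₁
  set E₂ : ℝ := Real.exp (2 * A * Real.log L * n) with hE₂
  have hLW1 : 1 ≤ (L : ℝ) ^ (2 * W) := one_le_pow₀ hLr
  -- the inner factor
  have h3 : 4 * c * B * (L : ℝ) ^ (2 * W) + 2 ≤ (4 * c + 2) * Real.exp n * (E₁ * E₂) := by
    have h31 : 4 * c * B * (L : ℝ) ^ (2 * W) + 2 ≤ (4 * c + 2) * (B * (L : ℝ) ^ (2 * W)) := by nlinarith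
    have h32 : B * (L : ℝ) ^ (2 * W) ≤ Real.exp n * (E₁ * E₂) :=
      mul_le_mul hexpn h2 (by positivity) (Real.exp_pos _).le
    nlinarith
  have h4 : (4 * c * B * (L : ℝ) ^ (2 * W) + 2) ^ d ≤ ((4 * c + 2) * Real.exp n * (E₁ * E₂)) ^ d :=
    pow_le_pow_left₀ (by positivity) h3 d
  -- assemble and rewrite the right-hand side as `C₀ · e^{κ₀ n}`
  have h5 : (2 * (W : ℝ) + 1) * (4 * c * B * (L : ℝ) ^ (2 * W) + 2) ^ d ≤
      ((3 + 2 * A) * Real.exp n) * ((4 * c + 2) * Real.exp n * (E₁ * E₂)) ^ d :=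
    mul_le_mul h1 h4 (by positivity) (by positivity)
  have hkey : ((3 + 2 * A) * Real.exp n) * ((4 * c + 2) * Real.exp n * (E₁ * E₂)) ^ d =
      ((3 + 2 * A) * (4 * c + 2) ^ d * Real.exp (2 * (1 + A) * d * Real.log L)) *
        Real.exp ((1 + d * (1 + 2 * A * Real.log L)) * n) := by
    rw [mul_pow, mul_pow, mul_pow, hE₁, hE₂, ← Real.exp_nat_mul, ← Real.exp_nat_mul, ← Real.exp_nat_mul]
    have e : ∀ u v w z : ℝ, Real.exp u * (Real.exp v * (Real.exp w * Real.exp z)) = Real.exp (u + v + w + z) := by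
      intro u v w z; rw [Real.exp_add, Real.exp_add, Real.exp_add]; ring
    calc (3 + 2 * A) * Real.exp n * ((4 * c + 2) ^ d * Real.exp (d * n) * (Real.exp (d * (2 * (1 + A) * Real.log L)) *
          Real.exp (d * (2 * A * Real.log L * n))))
        = (3 + 2 * A) * (4 * c + 2) ^ d * (Real.exp n * (Real.exp (d * n) * (Real.exp (d * (2 * (1 + A) * Real.log L)) *
          Real.exp (d * (2 * A * Real.log L * n))))) := by ring
      _ = (3 + 2 * A) * (4 * c + 2) ^ d * Real.exp (n + d * n + d * (2 * (1 + A) * Real.log L) + d * (2 * A * Real.log L * n)) := by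
          rw [e]
      _ = (3 + 2 * A) * (4 * c + 2) ^ d * Real.exp (2 * (1 + A) * d * Real.log L + (1 + d * (1 + 2 * A * Real.log L)) * n) := by
          congr 1; congr 1; ring
      _ = _ := by rw [Real.exp_add]; ring
  exact hconv.trans (h5.trans hkey.le)

end Exponential

/-! ## §3 The (2.61)-shape row sum over lattice representatives; §4 the (3.42) ⇒ (3.47) junction with both geometric hypotheses discharged -/

section RowSum
variable {L M₁ R k : ℕ} {Ω : ℕ → Set (Pt d)} {s : ℕ → ℝ}

/-- **THE (2.61)-SHAPE ROW SUM FOR `d_Ω` ON A GENUINE MULTI-LEVEL SEQUENCE** ([B6] Lemma 2.1 (2.61) «`sup_y Σ_{y′∈𝔅} e^{−αδ₀d(y,y′)} ≦ c₁(α)`» for the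
cell's distance): for a big-block domain sequence with geometric scales `s i = c·L^i`, a finite set `S` of lattice representatives, any base point `x` and
any rate `κ ≥ κ₀ + 1`, `Σ_{y∈S} e^{−κ·d_Ω(x,y)} ≤ C₀·e^{κ₀}·e/(e − 1)` with the explicit `C₀`, `κ₀` of `card_filter_msDistΩ_le_exp` (`A = 2c/(R·M₁)`):
`C₀ = (3 + 2A)(4c + 2)^d e^{2(1+A)d·log L}`, `κ₀ = 1 + d(1 + 2A·log L)`.  UNIFORM in `x`, in `S`, in the number of levels `k` and in the sequence. [folklore] -/
theorem sum_exp_neg_msDistΩ_reps_le (hΩ : BigDomainSeq L M₁ R k Ω) {c : ℝ} (hc : 0 < c) (hL : 1 ≤ L)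
    (hsc : ∀ i, s i = c * (L : ℝ) ^ i) (hRM : (0 : ℝ) < R * M₁) (S : Finset (Pt d)) (hS : ∀ y ∈ S, IsLevel L (ptIndex k Ω y) y)
    (x : Pt d) {κ : ℝ} (hκ : (1 + d * (1 + 2 * (2 * c / (R * M₁)) * Real.log L)) + 1 ≤ κ) :
    ∑ y ∈ S, Real.exp (-(κ * msDistΩ s k Ω x y)) ≤
      ((3 + 2 * (2 * c / (R * M₁))) * (4 * c + 2) ^ d * Real.exp (2 * (1 + 2 * c / (R * M₁)) * d * Real.log L)) *
        Real.exp (1 + d * (1 + 2 * (2 * c / (R * M₁)) * Real.log L)) * (Real.exp 1 / (Real.exp 1 - 1)) := by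
  classical
  have hs : ∀ i, 0 < s i := fun i => by rw [hsc i]; positivity
  have hLr : (1 : ℝ) ≤ L := by exact_mod_cast hL
  have hlog : 0 ≤ Real.log L := Real.log_nonneg hLr
  have hκ₀ : 0 ≤ 1 + d * (1 + 2 * (2 * c / (R * M₁)) * Real.log L) := by positivity
  exact sum_exp_neg_msDistΩ_le s hs k Ω x S hκ₀ (fun n => card_filter_msDistΩ_le_exp hΩ hc hL hsc hRM S hS x n) hκ

/-- **THE (2.63)-SHAPE COMPOSITION WITH ITS ROW SUM DISCHARGED** ([B6] (2.62)–(2.63), `n = 2`): over lattice representatives,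
`Σ_{y∈S} e^{−δ d_Ω(x,y)}·e^{−δ d_Ω(y,x″)} ≤ C₁·e^{−(1−α)δ·d_Ω(x,x″)}` as soon as `α·δ ≥ κ₀ + 1` (`0 ≤ α ≤ 1`), `C₁ = C₀e^{κ₀}·e/(e−1)`
(`SmallFieldDomainsRowSum.sum_exp_mul_exp_msDistΩ_le` BY NAME + `sum_exp_neg_msDistΩ_reps_le`). [folklore] -/
theorem sum_exp_mul_exp_msDistΩ_reps_le (hΩ : BigDomainSeq L M₁ R k Ω) {c : ℝ} (hc : 0 < c) (hL : 1 ≤ L)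
    (hsc : ∀ i, s i = c * (L : ℝ) ^ i) (hRM : (0 : ℝ) < R * M₁) (S : Finset (Pt d)) (hS : ∀ y ∈ S, IsLevel L (ptIndex k Ω y) y)
    {δ α : ℝ} (hδ : 0 ≤ δ) (hα0 : 0 ≤ α) (hα1 : α ≤ 1)
    (hκ : (1 + d * (1 + 2 * (2 * c / (R * M₁)) * Real.log L)) + 1 ≤ α * δ) (x x'' : Pt d) :
    ∑ y ∈ S, Real.exp (-(δ * msDistΩ s k Ω x y)) * Real.exp (-(δ * msDistΩ s k Ω y x''))
      ≤ ((3 + 2 * (2 * c / (R * M₁))) * (4 * c + 2) ^ d * Real.exp (2 * (1 + 2 * c / (R * M₁)) * d * Real.log L)) *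
          Real.exp (1 + d * (1 + 2 * (2 * c / (R * M₁)) * Real.log L)) * (Real.exp 1 / (Real.exp 1 - 1)) *
        Real.exp (-((1 - α) * δ * msDistΩ s k Ω x x'')) := by
  have hs : ∀ i, 0 < s i := fun i => by rw [hsc i]; positivity
  exact sum_exp_mul_exp_msDistΩ_le s hs k Ω S hδ hα0 hα1 (sum_exp_neg_msDistΩ_reps_le hΩ hc hL hsc hRM S hS x hκ)

/-- PRINT'S `𝔅` AS AN IMAGE: the block representatives `repPt` (`SmallFieldDomainsContourGap`) of any finite set of points ARE lattice representatives in
the sense of the hypothesis `hS` above (`ptIndex_repPt` + `isLevel_repPt`). [folklore] -/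
theorem isLevel_of_mem_image_repPt (hΩ : BigDomainSeq L M₁ R k Ω) (hL : 0 < L) (T : Finset (Pt d)) :
    ∀ y ∈ T.image (repPt L k Ω), IsLevel L (ptIndex k Ω y) y := by
  intro y hy
  obtain ⟨x, -, rfl⟩ := Finset.mem_image.mp hy
  rw [ptIndex_repPt hΩ hL]
  exact isLevel_repPt L k Ω x

/-- **THE (2.61)-SHAPE ROW SUM OVER PRINT'S `𝔅`** = the block representatives `y_{ι x′}(x′)` of an arbitrary finite set of points `T`
(p. 231 *"d(x, x′) = d(y_j(x), y_{j′}(x′))"*): `Σ_{y ∈ repPt(T)} e^{−κ d_Ω(x,y)} ≤ C₀e^{κ₀}·e/(e−1)` for `κ ≥ κ₀ + 1`. [folklore] -/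
theorem sum_exp_neg_msDistΩ_image_repPt_le (hΩ : BigDomainSeq L M₁ R k Ω) {c : ℝ} (hc : 0 < c) (hL : 1 ≤ L)
    (hsc : ∀ i, s i = c * (L : ℝ) ^ i) (hRM : (0 : ℝ) < R * M₁) (T : Finset (Pt d))
    (x : Pt d) {κ : ℝ} (hκ : (1 + d * (1 + 2 * (2 * c / (R * M₁)) * Real.log L)) + 1 ≤ κ) :
    ∑ y ∈ T.image (repPt L k Ω), Real.exp (-(κ * msDistΩ s k Ω x y)) ≤
      ((3 + 2 * (2 * c / (R * M₁))) * (4 * c + 2) ^ d * Real.exp (2 * (1 + 2 * c / (R * M₁)) * d * Real.log L)) *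
        Real.exp (1 + d * (1 + 2 * (2 * c / (R * M₁)) * Real.log L)) * (Real.exp 1 / (Real.exp 1 - 1)) :=
  sum_exp_neg_msDistΩ_reps_le hΩ hc hL hsc hRM _ (isLevel_of_mem_image_repPt hΩ (lt_of_lt_of_le Nat.zero_lt_one hL) T) x hκ

end RowSum

section Assembly
variable {L M₁ R k : ℕ} {Ω : ℕ → Set (Pt d)} {s : ℕ → ℝ} {E G : Type*} [SeminormedAddCommGroup E] [SeminormedAddCommGroup G]
  {f : Pt d → E} {P : Pt d → G}

/-- **[B9] p. 398 «(3.47) ⇐ (3.42) + LEMMA 2.1» ON THE SUBSTRATE'S `ℤ^d` OBJECTS, BOTH GEOMETRIC INPUTS PROVED**: `WSupLePrint.of_localDecay_msDistΩ`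
(`SmallFieldDomainsContour`, separation (2.60) already discharged there) with its (2.61)-shape ROW-SUM hypothesis `hrow` DISCHARGED by
`sum_exp_neg_msDistΩ_reps_le` for kernels localised at LATTICE REPRESENTATIVES `S ⊆ Ω₀`.  What remains a hypothesis is ONLY the (3.42)-shape blockwise
local-decay majorant `hP` — the printed ESTIMATE — plus the explicit rate condition `δ₀ − |γ|·log L·(2c)/(R·M₁) ≥ κ₀ + 1`. [folklore] -/
theorem WSupLePrint.of_localDecay_reps (hΩ : BigDomainSeq L M₁ R k Ω) {c : ℝ} (hc : 0 < c) (hL : 1 ≤ L) (hsc : ∀ i, s i = c * (L : ℝ) ^ i)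
    (hRM : 0 < (R : ℝ) * M₁) (S : Finset (Pt d)) (hS : ∀ x' ∈ S, x' ∈ Ω 0) (hSrep : ∀ y ∈ S, IsLevel L (ptIndex k Ω y) y)
    {B₀ δ₀ : ℝ} (hB₀ : 0 ≤ B₀) {σ γ : ℤ}
    (hP : ∀ x, x ∈ Ω 0 → ∀ u : Pt d → ℝ,
      (∀ x' ∈ S, ∀ x'', cubeIdx (L ^ ptIndex k Ω x') x'' = cubeIdx (L ^ ptIndex k Ω x') x' → ‖f x''‖ ≤ u x') →
        ‖P x‖ ≤ ∑ x' ∈ S, B₀ * s (ptIndex k Ω x) ^ σ * Real.exp (-(δ₀ * msDistΩ s k Ω x x')) * u x')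
    (hrate : (1 + d * (1 + 2 * (2 * c / (R * M₁)) * Real.log L)) + 1 ≤ δ₀ - γ.natAbs * Real.log L / ((R : ℝ) * M₁ / (2 * c)))
    {B : ℝ} (hB : 0 ≤ B) (hf : WSupLePrint s Ω γ f B) :
    WSupLePrint s Ω (σ + γ) P (B₀ * (L : ℝ) ^ γ.natAbs *
      (((3 + 2 * (2 * c / (R * M₁))) * (4 * c + 2) ^ d * Real.exp (2 * (1 + 2 * c / (R * M₁)) * d * Real.log L)) *
        Real.exp (1 + d * (1 + 2 * (2 * c / (R * M₁)) * Real.log L)) * (Real.exp 1 / (Real.exp 1 - 1))) * B) :=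
  WSupLePrint.of_localDecay_msDistΩ hΩ hc hL hsc hRM S hS hB₀ hP
    (fun x _ => sum_exp_neg_msDistΩ_reps_le hΩ hc hL hsc hRM S hSrep x hrate) hB hf

end Assembly

end Summit.QuantumFields.BalabanUV.T4Continuum.SmallFieldDomains

end
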